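import Summits.QuantumAdvantage.QuantumAdvantage.Theorems.SymplecticPurityDlogGraphFlatSpreadMain
import Literature.Combinatorics.Additive.BalogSzemerediGowersMultiplicative
import Literature.Combinatorics.Additive.SumsetFromPopularDifferences
import Literature.Combinatorics.Additive.IndexEnergy

/-!
# Crux `DlogGraphFlat` (stmt-QuantumAdvantage-10732), line `Sketch` — sector A: the spread-set
# energy bound R4 from popular differences (`stub_dlogSpreadOfPD`)

`(popular differences of sets with small product set) → stub_dlogSpreadEnergy`-statement: if every
zero-free `A ⊆ 𝔽_p` with `|A|² ≤ 2p`, `|AA| ≤ K|A|` has `r_{A−A}(d) ≤ C K^c |A|^{1−κ₀}` (`d ≠ 0`),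
then every translate `c + S_b` of the signed-digit spread set has multiplicative energy
`≤ C · 2^{(3−κ)|b|}`. Route: index energy → set energy (`index_energy_le`, fibres ≤ 2); BSG in
`𝔽_pˣ` (`Zhao2023_thm7136_mul`, proved) gives `A' ⊆ A`, `|A'A'| ≤ Q|A'|`, `Q = C₁K^{C₁}`; the
hypothesis bounds the popular differences of `A'` by `R₀ = C₂ Q^{c₂} N^{1−κ₀}`, `N = |A'|`;
Cauchy–Schwarz (`card_mul_card_le_two_mul_card_add`) and the cube + sub-cube bound
(`card_add_spread_le`) with the block length `2^m ≈ N/R₀` give `(4/3)^m ≤ 16Q` (`spread_main_pd`),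
whence `N^{κ₀} ≤ 2^{16} C₂ Q^{3+c₂}`, `|A| ≤ C₉ K^e` and `E×(A) ≤ C₉^{1/e} |A|^{3 − 1/e}`
(`spread_energy_bound_pd`). No new definitions.
-/

set_option linter.dupNamespace false -- D-0017: single-problem summit ⇒ `QuantumAdvantage.QuantumAdvantage` by design

namespace Summit.QuantumAdvantage.QuantumAdvantage.Theorems.SymplecticPurity

open Finset Literature.Computability.QuantumComplexity Literature.Computability.Cryptography
open Literature.Combinatorics.Additive
open scoped Pointwise Combinatorics.Additive

/-- The real bookkeeping of R4-from-popular-differences: if `N ≥ 1` satisfies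
`N · 2^m ≤ 4 · 3^m · 2^{k−m}` for every block length `m ≤ k` with `2^m · C₂' Q^{c₂} N^{1−κ₀} ≤ N`,
and `N ≤ 2^k ≤ 4QN`, then `N^{κ₀} ≤ 2^{16} C₂' Q^{3+c₂}` (choose `2^m ≈ N^{κ₀}/(C₂' Q^{c₂})`,
get `(4/3)^m ≤ 16Q`, hence `2^m ≤ 2^{14} Q³`). -/
theorem spread_main_pd (C₂' Q N κ₀ c₂ : ℝ) (k : ℕ) (hC₂' : 1 ≤ C₂') (hQ : 1 ≤ Q) (hN : 1 ≤ N)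
    (hκ₀1 : κ₀ ≤ 1) (hc₂ : 0 ≤ c₂) (hNk : N ≤ (2 : ℝ) ^ k) (h2k : (2 : ℝ) ^ k ≤ 4 * Q * N)
    (hcomb : ∀ m : ℕ, m ≤ k → (2 : ℝ) ^ m * (C₂' * Q ^ c₂ * N ^ (1 - κ₀)) ≤ N →
      N * (2 : ℝ) ^ m ≤ 4 * (3 : ℝ) ^ m * (2 : ℝ) ^ (k - m)) :
    N ^ κ₀ ≤ (2 : ℝ) ^ 16 * C₂' * Q ^ (3 + c₂) := by
  have hN0 : 0 < N := by linarith
  have hQ0 : 0 < Q := by linarith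
  have hQc : 1 ≤ Q ^ c₂ := Real.one_le_rpow hQ hc₂
  have hR₀1 : 1 ≤ C₂' * Q ^ c₂ * N ^ (1 - κ₀) :=
    one_le_mul_of_one_le_of_one_le (one_le_mul_of_one_le_of_one_le hC₂' hQc)
      (Real.one_le_rpow hN (by linarith))
  have hR₀0 : 0 < C₂' * Q ^ c₂ * N ^ (1 - κ₀) := by linarith
  set t : ℝ := N / (C₂' * Q ^ c₂ * N ^ (1 - κ₀)) with ht
  have htR : t * (C₂' * Q ^ c₂ * N ^ (1 - κ₀)) = N := div_mul_cancel₀ N hR₀0.ne'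
  -- `N^{κ₀} = t · C₂' Q^{c₂}`
  have hNκ : N ^ κ₀ = t * (C₂' * Q ^ c₂) := by
    have e1 : N ^ κ₀ = N ^ (1 : ℝ) / N ^ (1 - κ₀) := by rw [← Real.rpow_sub hN0]; ring_nf
    rw [e1, Real.rpow_one, ht]
    field_simp
  -- `t ≤ 2^{15} Q³`: trivial if `t < 1`, else via the block length `m` with `2^m ≤ t < 2^{m+1}`
  have ht15 : t ≤ 2 ^ 15 * Q ^ 3 := by
    have hQ3 : (1 : ℝ) ≤ Q ^ 3 := one_le_pow₀ hQ
    rcases lt_or_ge t 1 with hcase | hcase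
    · linarith
    obtain ⟨m, h2m, ht2m⟩ := exists_nat_pow_near hcase (by norm_num : (1 : ℝ) < 2)
    -- `m ≤ k` (indeed `2^m ≤ t ≤ N ≤ 2^k`) and admissibility `2^m R₀ = N`
    have htN : t ≤ N := div_le_self hN0.le hR₀1
    have hmk : m ≤ k :=
      (pow_le_pow_iff_right₀ (by norm_num : (1 : ℝ) < 2)).mp (h2m.trans (htN.trans hNk))
    have hmain := hcomb m hmk ((mul_le_mul_of_nonneg_right h2m hR₀0.le).trans htR.le)
    -- `N 4^m ≤ 16 Q 3^m N`, hence `4^m ≤ 16 Q 3^m`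
    have hpow : (2 : ℝ) ^ (k - m) * (2 : ℝ) ^ m = (2 : ℝ) ^ k := by
      rw [← pow_add, Nat.sub_add_cancel hmk]
    have h43 : (4 : ℝ) ^ m ≤ 16 * Q * (3 : ℝ) ^ m := by
      have h2 : N * (4 : ℝ) ^ m ≤ (16 * Q * (3 : ℝ) ^ m) * N := by
        have e4 : (4 : ℝ) ^ m = (2 : ℝ) ^ m * (2 : ℝ) ^ m := by rw [← mul_pow]; norm_num
        calc N * (4 : ℝ) ^ m = N * (2 : ℝ) ^ m * (2 : ℝ) ^ m := by rw [e4]; ring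
          _ ≤ 4 * (3 : ℝ) ^ m * (2 : ℝ) ^ (k - m) * (2 : ℝ) ^ m :=
              mul_le_mul_of_nonneg_right hmain (by positivity)
          _ = 4 * (3 : ℝ) ^ m * (2 : ℝ) ^ k := by rw [mul_assoc, hpow]
          _ ≤ 4 * (3 : ℝ) ^ m * (4 * Q * N) := mul_le_mul_of_nonneg_left h2k (by positivity)
          _ = (16 * Q * (3 : ℝ) ^ m) * N := by ring
      nlinarith
    -- `2^{m/3} ≤ 16 Q` and `2^m ≤ 4 · 8^{m/3} ≤ 2^{14} Q³`
    have hq1 : (2 : ℝ) ^ (m / 3) ≤ 16 * Q := by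
      have hR : (2 : ℝ) ^ (m / 3) * (3 : ℝ) ^ m ≤ (4 : ℝ) ^ m := by
        exact_mod_cast two_pow_div_three_mul_three_pow_le m
      have h3pos : (0 : ℝ) < (3 : ℝ) ^ m := by positivity
      nlinarith
    have h2mQ : (2 : ℝ) ^ m ≤ 2 ^ 14 * Q ^ 3 := by
      have hle : m ≤ 3 * (m / 3) + 2 := by omega
      have h0 : (0 : ℝ) ≤ (2 : ℝ) ^ (m / 3) := by positivity
      calc (2 : ℝ) ^ m ≤ (2 : ℝ) ^ (3 * (m / 3) + 2) := pow_le_pow_right₀ (by norm_num) hle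
        _ = 4 * ((2 : ℝ) ^ (m / 3)) ^ 3 := by rw [pow_add, mul_comm 3 (m / 3), pow_mul]; ring
        _ ≤ 4 * (16 * Q) ^ 3 := by have := pow_le_pow_left₀ h0 hq1 3; linarith
        _ = 2 ^ 14 * Q ^ 3 := by ring
    have e2 : (2 : ℝ) ^ (m + 1) = 2 * (2 : ℝ) ^ m := by rw [pow_succ]; ring
    rw [e2] at ht2m; linarith
  have hQ3c : Q ^ (3 + c₂) = Q ^ 3 * Q ^ c₂ := by rw [Real.rpow_add hQ0, Real.rpow_ofNat]
  have h0' : (0 : ℝ) ≤ C₂' * Q ^ (3 + c₂) := by positivity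
  calc N ^ κ₀ = t * (C₂' * Q ^ c₂) := hNκ
    _ ≤ (2 ^ 15 * Q ^ 3) * (C₂' * Q ^ c₂) := mul_le_mul_of_nonneg_right ht15 (by positivity)
    _ = 2 ^ 15 * (C₂' * Q ^ (3 + c₂)) := by rw [hQ3c]; ring
    _ ≤ 2 ^ 16 * C₂' * Q ^ (3 + c₂) := by nlinarith

/-- The set-energy bound of R4-from-popular-differences: for a zero-free `A` inside the translated
spread set with `2^k ≤ 2(|A|+1)`, `E×(A) ≤ C₉^{1/e} · 2^{(3 − 1/e)k}` with `e = C₁' s`,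
`C₉ = (2^{16} C₂')^{1/κ₀} C₁'^s`, `s = 1 + (3 + c₂)/κ₀`, `C₁' = max(C₁,1)`, `C₂' = max(C₂,1)`
(BSG constant `C₁`, popular-difference constants `κ₀, C₂, c₂`). The combinatorial step for a
block length `m ≤ k` (sub-mask `b'' ⊆ b`, `|b''| = m`): popular differences of `A'` +
Cauchy–Schwarz + cube/sub-cube sumset give `|A'| · 2^m ≤ 4 · 3^m · 2^{k−m}`. -/
theorem spread_energy_bound_pd {n p : ℕ} [Fact p.Prime] (hp2 : p ≠ 2) (h2p : 2 ^ n ≤ 2 * p)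
    (b : QReg n) (c : ZMod p) (k : ℕ) (hk : (Finset.univ.filter fun j => b j = true).card = k)
    (hb : 2 * k ≤ n) (C₁ κ₀ C₂ c₂ : ℝ) (hκ₀ : 0 < κ₀) (hκ₀1 : κ₀ ≤ 1) (hc₂ : 0 ≤ c₂)
    (hBSG : ∀ (A : Finset (ZMod p)) (K : ℝ), (0 : ZMod p) ∉ A → A.Nonempty → 1 ≤ K →
      (A.card : ℝ) ^ 3 / K ≤ Finset.mulEnergy A A →
      ∃ A' ⊆ A, (A.card : ℝ) ≤ C₁ * K ^ C₁ * A'.card ∧ ((A' * A').card : ℝ) ≤ C₁ * K ^ C₁ * A'.card)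
    (hPD : ∀ (A : Finset (ZMod p)) (K : ℝ), (0 : ZMod p) ∉ A → 1 ≤ K →
      (A.card : ℝ) ^ 2 ≤ 2 * (p : ℝ) → ((A * A).card : ℝ) ≤ K * A.card → ∀ d : ZMod p, d ≠ 0 →
      ((((A ×ˢ A).filter fun x : ZMod p × ZMod p => x.1 - x.2 = d).card : ℝ)) ≤
        C₂ * K ^ c₂ * (A.card : ℝ) ^ (1 - κ₀))
    (A : Finset (ZMod p)) (hA0 : (0 : ZMod p) ∉ A)
    (hAS : A ⊆ (Finset.univ.image fun u : QReg n => fun j => u j && b j).image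
      fun u => c + ((Nat.ofBits b : ZMod p) - 2 * (Nat.ofBits u : ZMod p)))
    (hAN : A.card ≤ 2 ^ k) (hkA : 2 ^ k ≤ 2 * (A.card + 1)) :
    (Finset.mulEnergy A A : ℝ) ≤
      ((2 ^ 16 * max C₂ 1) ^ (1 / κ₀) * (max C₁ 1) ^ (1 + (3 + c₂) / κ₀)) ^
          (1 / (max C₁ 1 * (1 + (3 + c₂) / κ₀))) *
        (2 : ℝ) ^ ((3 - 1 / (max C₁ 1 * (1 + (3 + c₂) / κ₀))) * (k : ℝ)) := by
  classical
  set C₁' : ℝ := max C₁ 1 with hC₁'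
  set C₂' : ℝ := max C₂ 1 with hC₂'
  have hC₁'1 : 1 ≤ C₁' := le_max_right _ _
  have hC₁C : C₁ ≤ C₁' := le_max_left _ _
  have hC₂'1 : 1 ≤ C₂' := le_max_right _ _
  have hC₂C : C₂ ≤ C₂' := le_max_left _ _
  set s : ℝ := 1 + (3 + c₂) / κ₀ with hs
  have hs0 : (0 : ℝ) ≤ (3 + c₂) / κ₀ := by positivity
  have hs1 : 1 ≤ s := by rw [hs]; linarith
  set e : ℝ := C₁' * s with he
  have he1 : 1 ≤ e := one_le_mul_of_one_le_of_one_le hC₁'1 hs1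
  have he0 : 0 < e := by linarith
  set C₉ : ℝ := (2 ^ 16 * C₂') ^ (1 / κ₀) * C₁' ^ s with hC₉
  have hC₉1 : 1 ≤ C₉ :=
    one_le_mul_of_one_le_of_one_le (Real.one_le_rpow (by nlinarith) (by positivity))
      (Real.one_le_rpow hC₁'1 (by linarith))
  have h2pos : (0 : ℝ) < 2 := by norm_num
  have hNR : ((2 ^ k : ℕ) : ℝ) = (2 : ℝ) ^ (k : ℝ) := by rw [Real.rpow_natCast]; push_cast; ring
  have hpow_split : ∀ t : ℝ, ((2 : ℝ) ^ (k : ℝ)) ^ t = (2 : ℝ) ^ (t * (k : ℝ)) := by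
    intro t; rw [← Real.rpow_mul h2pos.le]; ring_nf
  by_cases hAne : A.Nonempty
  swap
  · rw [Finset.not_nonempty_iff_eq_empty] at hAne
    rw [hAne, Finset.mulEnergy_empty_left]; push_cast; positivity
  have hAc0 : (0 : ℝ) < A.card := by exact_mod_cast hAne.card_pos
  set E : ℕ := Finset.mulEnergy A A with hEdef
  have hE1 : 0 < E := Finset.mulEnergy_pos hAne hAne
  have hE3 : E ≤ A.card ^ 3 := mulEnergy_le_card_pow_three A hA0
  have hER : (0 : ℝ) < E := by exact_mod_cast hE1
  set K : ℝ := (A.card : ℝ) ^ 3 / E with hKdef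
  have hK1 : 1 ≤ K := by
    rw [hKdef, one_le_div hER]; exact_mod_cast hE3
  have hKE : (A.card : ℝ) ^ 3 / K ≤ E := by
    have : (A.card : ℝ) ^ 3 / K = E := by rw [hKdef]; field_simp
    exact this.le
  obtain ⟨A', hA'A, h1, h2⟩ := hBSG A K hA0 hAne hK1 hKE
  set Q : ℝ := C₁' * K ^ C₁' with hQdef
  have hKC : (1 : ℝ) ≤ K ^ C₁' := Real.one_le_rpow hK1 (by linarith)
  have hQ1 : 1 ≤ Q := by rw [hQdef]; exact one_le_mul_of_one_le_of_one_le hC₁'1 hKC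
  have hQ0 : 0 < Q := by linarith
  have hCK : C₁ * K ^ C₁ ≤ Q := by
    rw [hQdef]
    exact mul_le_mul hC₁C (Real.rpow_le_rpow_of_exponent_le hK1 hC₁C) (by positivity)
      (by linarith)
  have h1' : (A.card : ℝ) ≤ Q * A'.card :=
    h1.trans (mul_le_mul_of_nonneg_right hCK (Nat.cast_nonneg _))
  have h2' : ((A' * A').card : ℝ) ≤ Q * A'.card :=
    h2.trans (mul_le_mul_of_nonneg_right hCK (Nat.cast_nonneg _))
  have hA'pos : (0 : ℝ) < A'.card := by
    by_contra h0
    push Not at h0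
    have : (A'.card : ℝ) = 0 := le_antisymm h0 (Nat.cast_nonneg _)
    rw [this, mul_zero] at h1'
    linarith
  have hA'1 : (1 : ℝ) ≤ A'.card := by
    have : 0 < A'.card := by exact_mod_cast hA'pos
    exact_mod_cast this
  have hA'0 : (0 : ZMod p) ∉ A' := fun h => hA0 (hA'A h)
  have hNk : (A'.card : ℝ) ≤ (2 : ℝ) ^ k := by
    exact_mod_cast (Finset.card_le_card hA'A).trans hAN
  -- `|A'|² ≤ 2^{2k} ≤ 2ⁿ ≤ 2p`
  have hN2p : (A'.card : ℝ) ^ 2 ≤ 2 * (p : ℝ) := by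
    have h22 : 2 ^ (2 * k) ≤ 2 * p := (Nat.pow_le_pow_right (by norm_num) hb).trans h2p
    have h22R : ((2 : ℝ) ^ k) ^ 2 ≤ 2 * (p : ℝ) := by
      rw [← pow_mul, mul_comm k 2]; exact_mod_cast h22
    exact (pow_le_pow_left₀ (Nat.cast_nonneg _) hNk 2).trans h22R
  -- popular differences of `A'`: `r(d) ≤ R := ⌊R₀⌋₊`, `R₀ = C₂' Q^{c₂} N^{1−κ₀}`
  have hR₀0 : 0 ≤ C₂' * Q ^ c₂ * (A'.card : ℝ) ^ (1 - κ₀) := by positivity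
  set R : ℕ := ⌊C₂' * Q ^ c₂ * (A'.card : ℝ) ^ (1 - κ₀)⌋₊ with hRdef
  have hRle : (R : ℝ) ≤ C₂' * Q ^ c₂ * (A'.card : ℝ) ^ (1 - κ₀) := Nat.floor_le hR₀0
  have hR : ∀ d : ZMod p, d ≠ 0 → ((A' ×ˢ A').filter fun z => z.1 - z.2 = d).card ≤ R := by
    intro d hd
    rw [hRdef]
    refine Nat.le_floor ((hPD A' Q hA'0 hQ1 hN2p h2' d hd).trans ?_)
    exact mul_le_mul_of_nonneg_right (mul_le_mul_of_nonneg_right hC₂C (by positivity))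
      (by positivity)
  -- the combinatorial step for every admissible block length `m`
  have hcomb : ∀ m : ℕ, m ≤ k →
      (2 : ℝ) ^ m * (C₂' * Q ^ c₂ * (A'.card : ℝ) ^ (1 - κ₀)) ≤ A'.card →
      (A'.card : ℝ) * (2 : ℝ) ^ m ≤ 4 * (3 : ℝ) ^ m * (2 : ℝ) ^ (k - m) := by
    intro m hmk hadm
    obtain ⟨b'', hsub, hb''⟩ := exists_submask b m (hk ▸ hmk)
    set Ub'' := Finset.univ.image fun u : QReg n => fun j => u j && b'' j with hUb''
    have hUb''c : Ub''.card = 2 ^ m := by rw [hUb'', card_patterns_eq b'', hb'']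
    set B := Ub''.image fun u => (Nat.ofBits b'' : ZMod p) - 2 * (Nat.ofBits u : ZMod p) with hB
    have hB2 : Ub''.card ≤ 2 * B.card :=
      Finset.card_le_mul_card_image Ub'' 2 fun y _ => spread_fibre_le_two hp2 h2p b'' _ y
    have hBle : B.card ≤ 2 ^ m := Finset.card_image_le.trans (le_of_eq hUb''c)
    have hBR : B.card * R ≤ A'.card := by
      have hB' : (B.card : ℝ) ≤ (2 : ℝ) ^ m := by exact_mod_cast hBle
      have h3 : (B.card : ℝ) * R ≤ A'.card :=
        (mul_le_mul hB' hRle (Nat.cast_nonneg _) (by positivity)).trans hadm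
      exact_mod_cast h3
    have hL2R : (A'.card : ℝ) * B.card ≤ 2 * (A' + B).card := by
      exact_mod_cast card_mul_card_le_two_mul_card_add A' B R hR hBR
    have hL3 := card_add_spread_le b b'' hsub c A' (hA'A.trans hAS)
    rw [card_filter_and_not b b'' hsub, hb'', hk] at hL3
    have hL3R : ((A' + B).card : ℝ) ≤ (3 : ℝ) ^ m * (2 : ℝ) ^ (k - m) := by
      have h := (Nat.cast_le (α := ℝ)).mpr hL3
      rw [Nat.cast_mul, Nat.cast_pow, Nat.cast_pow] at h
      simpa only [Nat.cast_ofNat] using h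
    have hB2R : (2 : ℝ) ^ m ≤ 2 * B.card := by
      have h := (Nat.cast_le (α := ℝ)).mpr hB2
      rw [hUb''c, Nat.cast_pow, Nat.cast_mul] at h
      simpa only [Nat.cast_ofNat] using h
    linarith [mul_le_mul_of_nonneg_left hB2R hA'pos.le]
  have h2kN : (2 : ℝ) ^ k ≤ 4 * Q * A'.card := by
    have h3 : ((2 ^ k : ℕ) : ℝ) ≤ 2 * ((A.card : ℝ) + 1) := by exact_mod_cast hkA
    push_cast at h3
    have hQA : 1 ≤ Q * A'.card := one_le_mul_of_one_le_of_one_le hQ1 hA'1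
    linarith
  have hmain := spread_main_pd C₂' Q (A'.card : ℝ) κ₀ c₂ k hC₂'1 hQ1 hA'1 hκ₀1 hc₂ hNk h2kN hcomb
  -- `N ≤ (2^16 C₂' Q^{3+c₂})^{1/κ₀}`
  have hNb : (A'.card : ℝ) ≤ ((2 : ℝ) ^ 16 * C₂' * Q ^ (3 + c₂)) ^ (1 / κ₀) := by
    have hx0 : (0 : ℝ) ≤ (A'.card : ℝ) ^ κ₀ := by positivity
    have hz0 : (0 : ℝ) ≤ 1 / κ₀ := by positivity
    calc (A'.card : ℝ) = ((A'.card : ℝ) ^ κ₀) ^ (1 / κ₀) := by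
          rw [one_div, Real.rpow_rpow_inv hA'pos.le hκ₀.ne']
      _ ≤ ((2 : ℝ) ^ 16 * C₂' * Q ^ (3 + c₂)) ^ (1 / κ₀) := Real.rpow_le_rpow hx0 hmain hz0
  -- `|A| ≤ C₉ K^e`
  have hAK : (A.card : ℝ) ≤ C₉ * K ^ e := by
    have e2 : ((2 : ℝ) ^ 16 * C₂' * Q ^ (3 + c₂)) ^ (1 / κ₀) =
        (2 ^ 16 * C₂') ^ (1 / κ₀) * Q ^ ((3 + c₂) / κ₀) := by
      rw [Real.mul_rpow (by positivity) (by positivity), ← Real.rpow_mul hQ0.le]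
      congr 2; ring
    have e3 : Q * Q ^ ((3 + c₂) / κ₀) = Q ^ s := by
      rw [hs, Real.rpow_add hQ0, Real.rpow_one]
    have e4 : Q ^ s = C₁' ^ s * K ^ e := by
      rw [hQdef, Real.mul_rpow (by linarith) (by positivity), ← Real.rpow_mul (by linarith), he]
    calc (A.card : ℝ) ≤ Q * A'.card := h1'
      _ ≤ Q * ((2 ^ 16 * C₂') ^ (1 / κ₀) * Q ^ ((3 + c₂) / κ₀)) := by
          rw [← e2]; exact mul_le_mul_of_nonneg_left hNb hQ0.le
      _ = (2 ^ 16 * C₂') ^ (1 / κ₀) * (Q * Q ^ ((3 + c₂) / κ₀)) := by ring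
      _ = C₉ * K ^ e := by rw [e3, e4, hC₉]; ring
  have hEn := energy_from_K_bound (A.card : ℝ) (E : ℝ) C₉ e hAc0 hER hC₉1 he0 hAK
  refine hEn.trans (mul_le_mul_of_nonneg_left ?_ (by positivity))
  rw [← hpow_split]
  exact Real.rpow_le_rpow (Nat.cast_nonneg _) (by rw [← hNR]; exact_mod_cast hAN)
    (by rw [sub_nonneg, div_le_iff₀ he0]; linarith)

/-- **Stub `stub_dlogSpreadOfPD`** (sector A, R4 from popular differences): the popular-difference
bound for zero-free sets with small product set implies the spread-set multiplicative energy bound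
`stub_dlogSpreadEnergy`. -/
theorem stub_dlogSpreadOfPD :
    (∃ κ₀ : ℝ, 0 < κ₀ ∧ κ₀ ≤ 1 ∧ ∃ C : ℝ, 0 < C ∧ ∃ c : ℝ, 0 < c ∧
      ∀ (p : ℕ) [Fact (Nat.Prime p)] (A : Finset (ZMod p)) (K : ℝ),
      (0 : ZMod p) ∉ A → 1 ≤ K → (A.card : ℝ) ^ 2 ≤ 2 * (p : ℝ) →
      ((A * A).card : ℝ) ≤ K * A.card → ∀ d : ZMod p, d ≠ 0 →
      ((((A ×ˢ A).filter fun x : ZMod p × ZMod p => x.1 - x.2 = d).card : ℝ)) ≤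
        C * K ^ c * (A.card : ℝ) ^ (1 - κ₀)) →
    ∃ κ : ℝ, 0 < κ ∧ ∃ C : ℝ, 0 < C ∧ ∀ (n p : ℕ), p.Prime →
    2 ^ n ≤ 2 * p → ∀ b : QReg n, 2 * (Finset.univ.filter fun j => b j = true).card ≤ n →
    ∀ c : ZMod p,
    (((((Finset.univ.image fun u : QReg n => fun j => u j && b j) ×ˢ
          (Finset.univ.image fun u : QReg n => fun j => u j && b j)) ×ˢ
        ((Finset.univ.image fun u : QReg n => fun j => u j && b j) ×ˢ
          (Finset.univ.image fun u : QReg n => fun j => u j && b j))).filter fun q =>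
        (c + ((Nat.ofBits b : ZMod p) - 2 * (Nat.ofBits q.1.1 : ZMod p))) *
          (c + ((Nat.ofBits b : ZMod p) - 2 * (Nat.ofBits q.2.2 : ZMod p))) =
        (c + ((Nat.ofBits b : ZMod p) - 2 * (Nat.ofBits q.1.2 : ZMod p))) *
          (c + ((Nat.ofBits b : ZMod p) - 2 * (Nat.ofBits q.2.1 : ZMod p)))).card : ℝ)
      ≤ C * (2 : ℝ) ^ ((3 - κ) * ((Finset.univ.filter fun j => b j = true).card : ℝ)) := by
  intro hPD
  obtain ⟨C₁, -, hBSG⟩ := Zhao2023_thm7136_mul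
  obtain ⟨κ₀, hκ₀, hκ₀1, C₂, -, c₂, hc₂, hPD'⟩ := hPD
  have hs0 : (0 : ℝ) ≤ (3 + c₂) / κ₀ := by positivity
  set e : ℝ := max C₁ 1 * (1 + (3 + c₂) / κ₀) with he
  have he1' : 1 ≤ e := one_le_mul_of_one_le_of_one_le (le_max_right C₁ 1) (by linarith)
  have he0 : 0 < e := by linarith
  have he1 : 1 / e ≤ 1 := by rwa [div_le_one he0]
  set C₉ : ℝ := (2 ^ 16 * max C₂ 1) ^ (1 / κ₀) * (max C₁ 1) ^ (1 + (3 + c₂) / κ₀) with hC₉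
  have hC₉0 : 0 < C₉ := by positivity
  refine ⟨1 / e, by positivity, 16 * C₉ ^ (1 / e) + 32, by positivity, ?_⟩
  intro n p hp h2p b hb c
  classical
  haveI := Fact.mk hp
  set k := (Finset.univ.filter fun j => b j = true).card with hk
  set Ub := Finset.univ.image fun u : QReg n => fun j => u j && b j with hUb
  have hUbc : Ub.card = 2 ^ k := card_patterns_eq b
  set x : QReg n → ZMod p := fun u => c + ((Nat.ofBits b : ZMod p) - 2 * (Nat.ofBits u : ZMod p))
    with hx
  set T := ((Ub ×ˢ Ub) ×ˢ (Ub ×ˢ Ub)).filter fun q => x q.1.1 * x q.2.2 = x q.1.2 * x q.2.1 with hT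
  change (T.card : ℝ) ≤ (16 * C₉ ^ (1 / e) + 32) * (2 : ℝ) ^ ((3 - 1 / e) * (k : ℝ))
  have h2pos : (0 : ℝ) < 2 := by norm_num
  have hexp0 : (0 : ℝ) ≤ (3 - 1 / e) * (k : ℝ) := mul_nonneg (by linarith) (Nat.cast_nonneg k)
  have hRHS1 : (1 : ℝ) ≤ (2 : ℝ) ^ ((3 - 1 / e) * (k : ℝ)) := Real.one_le_rpow (by norm_num) hexp0
  have hC90 : (0 : ℝ) ≤ 16 * C₉ ^ (1 / e) := by positivity
  -- small `n`: `k ≤ 1`, `T ⊆ Ub⁴` has at most 16 elements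
  by_cases hn : n ≤ 2
  · have h4 : 2 ^ k ≤ 2 := by
      calc 2 ^ k ≤ 2 ^ 1 := Nat.pow_le_pow_right (by norm_num) (by omega)
        _ = 2 := by norm_num
    have hT16 : (T.card : ℝ) ≤ 16 := by
      have h := Finset.card_filter_le ((Ub ×ˢ Ub) ×ˢ (Ub ×ˢ Ub))
        (fun q => x q.1.1 * x q.2.2 = x q.1.2 * x q.2.1)
      simp only [Finset.card_product, hUbc] at h
      have : T.card ≤ 16 :=
        (h.trans (Nat.mul_le_mul (Nat.mul_le_mul h4 h4) (Nat.mul_le_mul h4 h4))).trans (by norm_num)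
      exact_mod_cast this
    nlinarith
  -- `p` is odd
  have hp2 : p ≠ 2 := by
    intro h
    have : 2 ^ 3 ≤ 2 ^ n := Nat.pow_le_pow_right (by norm_num) (by omega)
    omega
  -- fibres of `x` and the index-energy reduction
  have hfib : ∀ y, (Ub.filter fun u => x u = y).card ≤ 2 := by
    intro y
    have h := spread_fibre_le_two hp2 h2p b (c + (Nat.ofBits b : ZMod p)) y
    have hEq : (Ub.filter fun u => x u = y) =
        (Ub.filter fun u => c + (Nat.ofBits b : ZMod p) - 2 * (Nat.ofBits u : ZMod p) = y) :=
      Finset.filter_congr fun u _ => by simp only [hx, add_sub_assoc]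
    rw [hEq]; exact h
  set S := Ub.image x with hS
  set A := S.erase 0 with hA
  have hTE := index_energy_le Ub x hfib
  rw [← hT, ← hS, ← hA, hUbc] at hTE
  have hA0 : (0 : ZMod p) ∉ A := Finset.notMem_erase 0 S
  have hS2 : Ub.card ≤ 2 * S.card := Finset.card_le_mul_card_image Ub 2 fun y _ => hfib y
  have hAS1 : S.card ≤ A.card + 1 := by
    have := Finset.pred_card_le_card_erase (s := S) (a := (0 : ZMod p)); rw [← hA] at this; omega
  have hAN : A.card ≤ 2 ^ k :=
    (Finset.card_erase_le).trans (Finset.card_image_le.trans (le_of_eq hUbc))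
  have hkA : 2 ^ k ≤ 2 * (A.card + 1) := by rw [← hUbc]; omega
  have hEbound := spread_energy_bound_pd hp2 h2p b c k hk.symm hb C₁ κ₀ C₂ c₂ hκ₀ hκ₀1 hc₂.le
    (fun A K => hBSG (ZMod p) A K) (fun A K => hPD' p A K) A hA0 (Finset.erase_subset _ _) hAN hkA
  rw [← hC₉, ← he] at hEbound
  -- assemble: `T ≤ 16 E×(A) + 16 · 4^k ≤ (16 C₉^{1/e} + 16) 2^{(3 − 1/e) k}`
  have hpow_split : ∀ t : ℝ, ((2 : ℝ) ^ (k : ℝ)) ^ t = (2 : ℝ) ^ (t * (k : ℝ)) := by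
    intro t; rw [← Real.rpow_mul h2pos.le]; ring_nf
  have hN2 : (2 : ℝ) ^ k * (2 : ℝ) ^ k ≤ (2 : ℝ) ^ ((3 - 1 / e) * (k : ℝ)) := by
    have e2 : (2 : ℝ) ^ k * (2 : ℝ) ^ k = ((2 : ℝ) ^ (k : ℝ)) ^ (2 : ℝ) := by
      rw [Real.rpow_two, Real.rpow_natCast]; ring
    rw [e2, hpow_split]
    exact Real.rpow_le_rpow_of_exponent_le (by norm_num)
      (mul_le_mul_of_nonneg_right (by linarith) (Nat.cast_nonneg _))
  have hTR : (T.card : ℝ) ≤ 16 * (Finset.mulEnergy A A : ℝ) + 16 * ((2 : ℝ) ^ k * (2 : ℝ) ^ k) := by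
    exact_mod_cast hTE
  have h0 : (0 : ℝ) ≤ (2 : ℝ) ^ ((3 - 1 / e) * (k : ℝ)) := by positivity
  linarith [hEbound, hN2, hTR]

end Summit.QuantumAdvantage.QuantumAdvantage.Theorems.SymplecticPurity
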